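import Literature.AlgebraicGeometry.Resolution.MuPTorsorLocalUniformizationRelative
import Mathlib.RingTheory.AlgebraicIndependent.TranscendenceBasis
import Mathlib.Algebra.Polynomial.Lifts
import HarnessLib

/-!
# Reduction of (relative) local uniformization to residually algebraic valuations

**Sources.** O. Zariski, P. Samuel, *Commutative Algebra* II, Ch. VI §14 (dimension of a place;
extension of the ground field inside the valuation ring); F.-V. Kuhlmann, *Valuation theoretic
and model theoretic aspects of local uniformization*, in: Resolution of Singularities (Obergurgl
1997), Progr. Math. 181 (2000), §§ 1–2 (the "ground field may be enlarged inside `O_v`" device);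
J. Novacoski, M. Spivakovsky, arXiv:1204.4751, Thm. 1.1 (reduction to rank one, PROVED in the
tree). Everything in this file is folklore bookkeeping, recorded as a combination; no new
named fact.

**What is recorded.** For a valuation ring `O ⊇ k` of a finitely generated extension `K/k`:

* `IsResiduallyAlgebraic k O` — the residue field of `O` is algebraic over (the image of) `k`,
  stated elementarily: every `t ∈ O` satisfies `v(P(t)) < 1` for some nonzero `P ∈ k[X]`
  ("`O` is a zero-dimensional valuation of `K/k`");
* `exists_intermediateField_isResiduallyAlgebraic` — there is a finitely generated intermediate
  field `k ⊆ k₁ ⊆ O` over which `O` is residually algebraic (lift a transcendence basis of the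
  residue field; it is finite since `trdeg_k κ(O) ≤ trdeg_k K`);
* `RelLocalUniformization.of_ground_intermediateField` — relative local uniformization of `O`
  over a finitely generated intermediate ground field `k₁ ⊆ O` implies it over `k` (clear the
  denominators of `k₁ = Frac k[u]`, which are units of `O`);
* `relLocalUniformization_of_rankOne_residuallyAlgebraic_relCoreSteps` and
  `relLocalUniformization_iff_rankOne_residuallyAlgebraic_relCoreSteps` — combined with the
  rank-one reduction of `MuPTorsorLocalUniformizationRelative`: granted `Temkin2013HeightLeOne`
  and `CossartPiltant2019LU3`, relative local uniformization in characteristic `p` (all ground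
  fields) is EQUIVALENT to the core model-form `μ_p`-torsor steps at the RANK-ONE, RESIDUALLY
  ALGEBRAIC valuation rings ("generalised arcs": `v : K ↪ κ((t^Γ))`, `Γ ⊆ ℝ`, `κ/k` algebraic);
  `localUniformizationInChar_of_rankOne_residuallyAlgebraic_relCoreSteps`.
-/

noncomputable section

open IsLocalRing Cardinal

namespace Literature.AlgebraicGeometry.Resolution

section Defs

variable (k : Type) {K : Type} [Field k] [Field K] [Algebra k K] (O : ValuationSubring K)

/-- **`O` is residually algebraic over `k`** (a zero-dimensional valuation of `K/k`): the
residue of every `t ∈ O` is algebraic over `k`, i.e. `v(P(t)) < 1` for some nonzero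
`P ∈ k[X]`. [folklore] -/
def IsResiduallyAlgebraic : Prop :=
  ∀ t ∈ O, ∃ P : Polynomial k, P ≠ 0 ∧ O.valuation (Polynomial.aeval t P) < 1

end Defs

section GroundField

variable {k K : Type} [Field k] [Field K] [Algebra k K]

/-- A finitely generated field extension is algebraic over the subalgebra generated by its
generators. [folklore] -/
theorem isAlgebraic_adjoin_of_adjoin_eq_top (u : Finset K)
    (hu : IntermediateField.adjoin k (u : Set K) = ⊤) :
    Algebra.IsAlgebraic (Algebra.adjoin k (u : Set K)) K := by
  classical
  refine ⟨fun z => ?_⟩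
  have hz : z ∈ IntermediateField.adjoin k (u : Set K) := by
    rw [hu]
    trivial
  obtain ⟨a, ha, b, hb, rfl⟩ := IntermediateField.mem_adjoin_iff_div.mp hz
  by_cases hb0 : b = 0
  · rw [hb0, div_zero]
    exact isAlgebraic_zero
  refine ⟨Polynomial.C (⟨b, hb⟩ : Algebra.adjoin k (u : Set K)) * Polynomial.X -
    Polynomial.C ⟨a, ha⟩, ?_, ?_⟩
  · intro h
    have h1 := congrArg (fun q => Polynomial.coeff q 1) h
    simp only [Polynomial.coeff_sub, Polynomial.coeff_C_mul, Polynomial.coeff_X_one, mul_one,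
      Polynomial.coeff_C, one_ne_zero, if_false, sub_zero, Polynomial.coeff_zero] at h1
    exact hb0 (congrArg Subtype.val h1)
  · simp only [map_sub, map_mul, Polynomial.aeval_C, Polynomial.aeval_X]
    rw [Subalgebra.algebraMap_def, Subalgebra.algebraMap_def]
    simp [mul_div_cancel₀ _ hb0]

set_option maxHeartbeats 400000 in
/-- **Enlarging the ground field inside `O`.** For a valuation ring `O ⊇ k` of a finitely
generated extension `K/k` there is a finitely generated intermediate field `k ⊆ k₁ ⊆ O` over
which `O` is residually algebraic: `k₁ = k(T)` for lifts `T ⊆ O` of a transcendence basis of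
the residue field over `k` (finite, as `trdeg_k κ(O) ≤ trdeg_k O ≤ trdeg_k K < ∞`); nonzero
elements of `k[T]` have nonzero residue, so `k(T) ⊆ O`. [folklore] -/
theorem exists_intermediateField_isResiduallyAlgebraic (hfg : (⊤ : IntermediateField k K).FG)
    (O : ValuationSubring K) (hk : ∀ c : k, algebraMap k K c ∈ O) :
    ∃ k₁ : IntermediateField k K, k₁.FG ∧ (∀ x : k₁, (x : K) ∈ O) ∧
      IsResiduallyAlgebraic k₁ O := by
  classical
  -- `k`-algebra structures on `O` and on its residue field `κ`
  let ι : k →+* O := (algebraMap k K).codRestrict O hk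
  letI : Algebra k O := ι.toAlgebra
  haveI : IsScalarTower k O K := IsScalarTower.of_algebraMap_eq fun _ => rfl
  haveI : IsScalarTower k O (ResidueField O) := inferInstance
  have hinjκ : Function.Injective (algebraMap k (ResidueField O)) :=
    (algebraMap k (ResidueField O)).injective
  haveI : FaithfulSMul k (ResidueField O) :=
    (faithfulSMul_iff_algebraMap_injective k (ResidueField O)).mpr hinjκ
  obtain ⟨s, hs⟩ := exists_isTranscendenceBasis k (ResidueField O)
  -- `s` is finite
  obtain ⟨u, hu⟩ := hfg
  have hsfin : s.Finite := by
    haveI := isAlgebraic_adjoin_of_adjoin_eq_top u hu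
    have h1 : #s = Algebra.trdeg k (ResidueField O) := hs.cardinalMk_eq_trdeg
    have h2 : Algebra.trdeg k (ResidueField O) ≤ Algebra.trdeg k O :=
      trdeg_le_of_surjective (IsScalarTower.toAlgHom k O (ResidueField O))
        Ideal.Quotient.mk_surjective
    have h3 : Algebra.trdeg k O ≤ Algebra.trdeg k K :=
      trdeg_le_of_injective (IsScalarTower.toAlgHom k O K) Subtype.val_injective
    have h4 : Algebra.trdeg k K ≤ #(↥(u : Set K)) :=
      Algebra.IsAlgebraic.trdeg_le_cardinalMk k (u : Set K)
    have h5 : #(↥(u : Set K)) < ℵ₀ := lt_aleph0_iff_set_finite.mpr u.finite_toSet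
    exact lt_aleph0_iff_set_finite.mp (h1 ▸ (h2.trans h3) |>.trans h4 |>.trans_lt h5)
  haveI : Finite s := hsfin.to_subtype
  -- lifts of the basis
  have hres : ∀ y : ResidueField O, ∃ x : O, residue O x = y := Ideal.Quotient.mk_surjective
  choose L hL using hres
  let fO : s → O := fun y => L y
  let f : s → K := fun y => ((L y : O) : K)
  set T : Set K := Set.range f with hT
  have hTfin : T.Finite := Set.finite_range f
  have hTO : T ⊆ O := by
    rintro _ ⟨y, rfl⟩
    exact (L y).2
  set D : Subalgebra k K := Algebra.adjoin k T with hD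
  have hDO : D.toSubring ≤ O.toSubring := adjoin_toSubring_le_of_subset_valuationSubring O hk hTO
  -- nonzero elements of `D = k[T]` have nonzero residue
  have hkey : ∀ q ∈ D, O.valuation q < 1 → q = 0 := by
    intro q hq hvq
    rw [hD, hT, Algebra.adjoin_range_eq_range_aeval, AlgHom.mem_range] at hq
    obtain ⟨P, rfl⟩ := hq
    have h1 : MvPolynomial.aeval f P = ((MvPolynomial.aeval fO P : O) : K) := by
      have := congrArg (fun φ => φ P)
        (MvPolynomial.comp_aeval (IsScalarTower.toAlgHom k O K) (f := fO))
      exact this.symm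
    have h2 : MvPolynomial.aeval fO P ∈ maximalIdeal O :=
      (ValuationSubring.valuation_lt_one_iff O _).mpr (by rwa [← h1])
    have h3 : residue O (MvPolynomial.aeval fO P) = 0 := (residue_eq_zero_iff _).mpr h2
    have h4 : residue O (MvPolynomial.aeval fO P) = MvPolynomial.aeval ((↑) : s → ResidueField O) P := by
      have := congrArg (fun φ => φ P)
        (MvPolynomial.comp_aeval (IsScalarTower.toAlgHom k O (ResidueField O)) (f := fO))
      simp only [AlgHom.comp_apply, IsScalarTower.coe_toAlgHom', ResidueField.algebraMap_eq] at this
      have hfun : (fun i => residue O (fO i)) = ((↑) : s → ResidueField O) :=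
        funext fun y => hL y
      rw [this, hfun]
    have h5 : P = 0 := hs.1.eq_zero_of_aeval_eq_zero P (h4 ▸ h3)
    rw [h5, map_zero]
  have hunit : ∀ q ∈ D, q ≠ 0 → O.valuation q = 1 := fun q hq hq0 =>
    eq_of_le_of_not_lt ((O.valuation_le_one_iff q).mpr (hDO hq)) fun h => hq0 (hkey q hq h)
  -- the intermediate field `k₁ = k(T) ⊆ O`
  set k₁ : IntermediateField k K := IntermediateField.adjoin k T with hk₁
  have hk₁O : ∀ x : k₁, (x : K) ∈ O := by
    intro x
    obtain ⟨r, hr, q, hq, hx⟩ := IntermediateField.mem_adjoin_iff_div.mp x.2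
    rw [hx]
    by_cases hq0 : q = 0
    · rw [hq0, div_zero]
      exact O.zero_mem
    · rw [← O.valuation_le_one_iff, map_div₀, hunit q hq hq0, div_one]
      exact (O.valuation_le_one_iff r).mpr (hDO hr)
  obtain ⟨Tf, hTf⟩ : ∃ Tf : Finset K, (Tf : Set K) = T := ⟨hTfin.toFinset, hTfin.coe_toFinset⟩
  refine ⟨k₁, ⟨Tf, by rw [hTf]⟩, hk₁O, ?_⟩
  -- `O` is residually algebraic over `k₁`
  intro t ht
  set t' : O := ⟨t, ht⟩ with ht'
  haveI := hs.isAlgebraic_field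
  set F₀ : IntermediateField k (ResidueField O) :=
    IntermediateField.adjoin k (Set.range ((↑) : s → ResidueField O)) with hF₀
  obtain ⟨Q, hQ0, hQ⟩ :=
    (Algebra.IsAlgebraic.isAlgebraic (R := F₀) (residue O t') : IsAlgebraic F₀ (residue O t'))
  -- the residue map on `k₁`
  let j : k₁ →+* O := (algebraMap k₁ K).codRestrict O fun x => hk₁O x
  let σ : k₁ →+* ResidueField O := (residue O).comp j
  have hσk : ∀ c : k, σ (algebraMap k k₁ c) = algebraMap k (ResidueField O) c := by
    intro c
    rw [IsScalarTower.algebraMap_apply k O (ResidueField O), ResidueField.algebraMap_eq]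
    show residue O (j (algebraMap k k₁ c)) = residue O (algebraMap k O c)
    exact congrArg _ (Subtype.ext ((IsScalarTower.algebraMap_apply k k₁ K c).symm))
  let F₁ : IntermediateField k (ResidueField O) :=
    σ.fieldRange.toIntermediateField fun c => ⟨algebraMap k k₁ c, hσk c⟩
  have hF₀F₁ : F₀ ≤ F₁ := by
    rw [hF₀]
    refine IntermediateField.adjoin_le_iff.mpr ?_
    rintro _ ⟨y, rfl⟩
    refine ⟨⟨f y, IntermediateField.subset_adjoin k T ⟨y, rfl⟩⟩, ?_⟩
    show residue O (j _) = (y : ResidueField O)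
    have : j ⟨f y, IntermediateField.subset_adjoin k T ⟨y, rfl⟩⟩ = L y := Subtype.ext rfl
    rw [this]
    exact hL y
  have hrange : ∀ c : F₀, (c : ResidueField O) ∈ Set.range σ := fun c =>
    RingHom.mem_fieldRange.mp (hF₀F₁ c.2)
  set Q' : Polynomial (ResidueField O) := Q.map (algebraMap F₀ (ResidueField O)) with hQ'
  have hQ'0 : Q' ≠ 0 := (Polynomial.map_ne_zero_iff (algebraMap F₀ (ResidueField O)).injective).mpr hQ0
  have hQ't : Q'.eval (residue O t') = 0 := by
    rw [hQ', Polynomial.eval_map, ← Polynomial.aeval_def]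
    exact hQ
  have hlifts : Q' ∈ Polynomial.lifts σ := by
    rw [Polynomial.lifts_iff_coeff_lifts]
    intro n
    rw [hQ', Polynomial.coeff_map]
    exact hrange _
  obtain ⟨P, hPQ, -⟩ := Polynomial.exists_degree_eq_of_mem_lifts hlifts
  have hP0 : P ≠ 0 := by
    rintro rfl
    rw [Polynomial.map_zero] at hPQ
    exact hQ'0 hPQ.symm
  refine ⟨P, hP0, ?_⟩
  letI : Algebra k₁ O := j.toAlgebra
  haveI : IsScalarTower k₁ O K := IsScalarTower.of_algebraMap_eq fun _ => rfl
  have h1 : Polynomial.aeval t P = ((Polynomial.aeval t' P : O) : K) := by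
    rw [show t = IsScalarTower.toAlgHom k₁ O K t' from rfl, Polynomial.aeval_algHom_apply]
    rfl
  have h2 : residue O (Polynomial.aeval t' P) = 0 := by
    rw [Polynomial.aeval_def, Polynomial.hom_eval₂, ← Polynomial.eval_map]
    show Polynomial.eval (residue O t') (P.map σ) = 0
    rw [hPQ]
    exact hQ't
  rw [h1, ← ValuationSubring.valuation_lt_one_iff]
  exact (residue_eq_zero_iff _).mp h2

/-- **Relative local uniformization descends along a finitely generated extension of the ground
field inside `O`.** If `k ⊆ k₁ ⊆ O` with `k₁/k` finitely generated and `O` satisfies relative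
local uniformization over `k₁`, then it does over `k`: for `R = k[t] ⊆ O`, uniformize
`k₁[t] ⊆ A₁ = k₁[g]` over `k₁` and take `A = k[u, g, t]` with `k₁ = k(u)`; since the nonzero
elements of `k[u]` are units of `O`, `A ⊆ A₁ ⊆ A_{𝔪_O ∩ A}` and the two local rings at the centre
coincide. [folklore] -/
theorem RelLocalUniformization.of_ground_intermediateField (k₁ : IntermediateField k K)
    (hk₁fg : k₁.FG) (O : ValuationSubring K) (hk₁O : ∀ x : k₁, (x : K) ∈ O)
    (H : RelLocalUniformization k₁ K O) : RelLocalUniformization k K O := by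
  classical
  intro R hRfg hRfr hRO
  have hk₁ : ∀ c : k₁, algebraMap k₁ K c ∈ O := hk₁O
  obtain ⟨u, hu⟩ := hk₁fg
  obtain ⟨t, ht⟩ := hRfg
  -- `R₁ = k₁[t]`
  set R₁ : Subalgebra k₁ K := Algebra.adjoin k₁ (t : Set K) with hR₁
  have htR : (t : Set K) ⊆ R := by
    rw [← ht]
    exact Algebra.subset_adjoin
  have htO : (t : Set K) ⊆ O := fun x hx => hRO (htR hx)
  have hR₁O : R₁.toSubring ≤ O.toSubring :=
    adjoin_toSubring_le_of_subset_valuationSubring O hk₁ htO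
  have hRR₁ : (R : Set K) ⊆ R₁ := by
    rw [← ht]
    exact Algebra.adjoin_le (S := R₁.restrictScalars k) Algebra.subset_adjoin
  haveI := hRfr
  have hR₁fr : IsFractionRing R₁ K := by
    refine IsFractionRing.of_field R₁ K fun z => ?_
    obtain ⟨a, b, -, rfl⟩ := IsFractionRing.div_surjective (A := R) z
    exact ⟨⟨a, hRR₁ a.2⟩, ⟨b, hRR₁ b.2⟩, rfl⟩
  obtain ⟨A₁, hA₁O, hR₁A₁, ⟨g, hg⟩, hreg₁⟩ := H R₁ (Subalgebra.fg_adjoin_finset _) hR₁fr hR₁O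
  -- `A = k[u ∪ g ∪ t]`
  set A : Subalgebra k K := Algebra.adjoin k (↑(u ∪ g ∪ t) : Set K) with hA
  have hcoe : (↑(u ∪ g ∪ t) : Set K) = (u : Set K) ∪ g ∪ t := by
    rw [Finset.coe_union, Finset.coe_union]
  have huA₁ : (u : Set K) ⊆ A₁ := fun x hx => by
    have hx₁ : x ∈ k₁ := by
      rw [← hu]
      exact IntermediateField.subset_adjoin k _ hx
    exact A₁.algebraMap_mem (⟨x, hx₁⟩ : k₁)
  have hgA₁ : (g : Set K) ⊆ A₁ := by
    rw [← hg]
    exact Algebra.subset_adjoin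
  have htA₁ : (t : Set K) ⊆ A₁ := fun x hx => hR₁A₁ (Algebra.subset_adjoin hx)
  have hAA₁ : (A : Set K) ⊆ A₁ := by
    rw [hA]
    refine Algebra.adjoin_le (S := A₁.restrictScalars k) ?_
    rw [hcoe]
    exact Set.union_subset (Set.union_subset huA₁ hgA₁) htA₁
  have hAO : A.toSubring ≤ O.toSubring := fun x hx => hA₁O (hAA₁ hx)
  have huA : (u : Set K) ⊆ A := by
    rw [hA, hcoe]
    exact fun x hx => Algebra.subset_adjoin (Or.inl (Or.inl hx))
  have hgA : (g : Set K) ⊆ A := by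
    rw [hA, hcoe]
    exact fun x hx => Algebra.subset_adjoin (Or.inl (Or.inr hx))
  have hRA : R ≤ A := by
    rw [← ht, hA, hcoe]
    exact Algebra.adjoin_mono fun x hx => Or.inr hx
  -- `k₁ ⊆ A_{𝔪_O ∩ A}`
  have hk₁loc : ∀ c : k₁, (c : K) ∈ locAtCentre A.toSubring O := by
    intro c
    have hc : (c : K) ∈ IntermediateField.adjoin k (u : Set K) := by
      rw [hu]
      exact c.2
    obtain ⟨r, hr, q, hq, hcq⟩ := IntermediateField.mem_adjoin_iff_div.mp hc
    have hkuA : Algebra.adjoin k (u : Set K) ≤ A := Algebra.adjoin_le huA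
    by_cases hq0 : q = 0
    · rw [hcq, hq0, div_zero]
      exact Subring.zero_mem _
    refine ⟨r, hkuA hr, q, hkuA hq, ?_, hcq⟩
    have hq₁ : q ∈ k₁ := by
      rw [← hu]
      exact IntermediateField.algebra_adjoin_le_adjoin k _ hq
    have hqO : q ∈ O := hk₁O ⟨q, hq₁⟩
    have hqiO : q⁻¹ ∈ O := hk₁O ⟨q⁻¹, inv_mem hq₁⟩
    refine le_antisymm ((O.valuation_le_one_iff q).mpr hqO) ?_
    have hle : O.valuation q⁻¹ ≤ 1 := (O.valuation_le_one_iff q⁻¹).mpr hqiO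
    rw [map_inv₀] at hle
    have hpos : 0 < O.valuation q := by
      rw [pos_iff_ne_zero]
      exact (map_ne_zero O.valuation).mpr hq0
    exact (inv_le_one₀ hpos).mp hle
  -- `A₁ ⊆ A_{𝔪_O ∩ A}`, hence the local rings at the centre agree
  let Lk₁ : Subalgebra k₁ K :=
    { (locAtCentre A.toSubring O) with
      algebraMap_mem' := fun c => hk₁loc c }
  have hA₁loc : A₁.toSubring ≤ locAtCentre A.toSubring O := by
    have h1 : A₁ ≤ Lk₁ := by
      rw [← hg]
      exact Algebra.adjoin_le fun x hx => le_locAtCentre _ O (hgA hx)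
    exact fun x hx => h1 hx
  have hloc : locAtCentre A₁.toSubring O = locAtCentre A.toSubring O := by
    refine le_antisymm ?_ (locAtCentre_mono O (show A.toSubring ≤ A₁.toSubring from
      fun x hx => hAA₁ hx))
    have h1 := locAtCentre_mono O hA₁loc
    rwa [locAtCentre_locAtCentre] at h1
  have hregA : IsRegularLocalRing (locAtCentre A.toSubring O) := by
    rw [← hloc]
    exact (isRegularLocalRing_locAtCentre_iff hA₁O).mpr hreg₁
  exact ⟨A, hAO, hRA, Subalgebra.fg_adjoin_finset _,
    (isRegularLocalRing_locAtCentre_iff hAO).mp hregA⟩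

/-- **Relative local uniformization of `O` over `k` follows from relative local uniformization
of `O` over the (finitely generated) intermediate ground fields `k₁ ⊆ O` over which `O` is
residually algebraic.** [folklore] -/
theorem relLocalUniformization_of_forall_isResiduallyAlgebraic
    (hfg : (⊤ : IntermediateField k K).FG) (O : ValuationSubring K)
    (hk : ∀ c : k, algebraMap k K c ∈ O)
    (H : ∀ k₁ : IntermediateField k K, (∀ x : k₁, (x : K) ∈ O) → IsResiduallyAlgebraic k₁ O →
      RelLocalUniformization k₁ K O) :
    RelLocalUniformization k K O := by
  obtain ⟨k₁, hfg₁, hk₁O, hra⟩ := exists_intermediateField_isResiduallyAlgebraic hfg O hk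
  exact RelLocalUniformization.of_ground_intermediateField k₁ hfg₁ O hk₁O (H k₁ hk₁O hra)

end GroundField

/-! ## Rank one and residually algebraic -/

section Global

variable {p : ℕ}

/-- **The core model-form steps at the RANK-ONE, RESIDUALLY ALGEBRAIC valuation rings (over all
ground fields of characteristic `p`) give relative local uniformization of every valuation ring
over every field of characteristic `p`** (Novacoski–Spivakovsky's reduction to rank one, proved
in the tree; enlarging the ground field inside `O`; Temkin in height one; Cossart–Piltant in
dimension `≤ 3`; Cutkosky at Abhyankar places).
[cite: NovacoskiSpivakovsky2014, Thm. 1.1; Temkin2013, Section 4.1; CossartPiltant2019, Thm. 1.1; Cutkosky2022, Thm. 1.3] -/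
theorem relLocalUniformization_of_rankOne_residuallyAlgebraic_relCoreSteps [Fact p.Prime]
    (hT₁ : Temkin2013HeightLeOne.{0}) (hCP : CossartPiltant2019LU3.{0})
    (H : ∀ (k K : Type) [Field k] [CharP k p] [Field K] [Algebra k K],
      (⊤ : IntermediateField k K).FG → ∀ O : ValuationSubring K,
        Nonempty O.valuation.RankOne → (∀ c : k, algebraMap k K c ∈ O) →
          IsResiduallyAlgebraic k O → RelMuPTorsorCoreStepsAt p k O)
    (k K : Type) [Field k] [CharP k p] [Field K] [Algebra k K] (O : ValuationSubring K) :
    RelLocalUniformization k K O := by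
  refine NovacoskiSpivakovsky2014_holds k (fun K _ _ O hr => ?_) K O
  intro R hRfg hRfr hRO
  have hk : ∀ c : k, algebraMap k K c ∈ O := algebraMap_mem_of_le O R hRO
  have hfg : (⊤ : IntermediateField k K).FG := fg_top_of_model R hRfg hRfr
  refine relLocalUniformization_of_forall_isResiduallyAlgebraic hfg O hk (fun k₁ hk₁O hra => ?_)
    R hRfg hRfr hRO
  haveI : CharP k₁ p := charP_of_injective_algebraMap (algebraMap k k₁).injective p
  have hfg₁ : (⊤ : IntermediateField k₁ K).FG := intermediateField_fg_top_of_fg_top k₁ hfg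
  have hk₁ : ∀ c : k₁, algebraMap k₁ K c ∈ O := hk₁O
  exact relLocalUniformization_of_relCoreStepsAt_of_rankOne hT₁ hCP O hr hk₁
    (H k₁ K hfg₁ O hr hk₁ hra)

/-- **Relative local uniformization in characteristic `p` ⟺ the core model-form `μ_p`-torsor
steps at the rank-one, residually algebraic valuation rings** (over all ground fields of
characteristic `p`), granted Temkin's height-one theorem and Cossart–Piltant's local
uniformization in dimension `≤ 3`; `⇒` is unconditional.
[cite: NovacoskiSpivakovsky2014, Thm. 1.1; Temkin2013, Section 4.1; CossartPiltant2019, Thm. 1.1; Cutkosky2022, Thm. 1.3] -/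
theorem relLocalUniformization_iff_rankOne_residuallyAlgebraic_relCoreSteps [Fact p.Prime]
    (hT₁ : Temkin2013HeightLeOne.{0}) (hCP : CossartPiltant2019LU3.{0}) :
    (∀ (k K : Type) [Field k] [CharP k p] [Field K] [Algebra k K] (O : ValuationSubring K),
        (∀ c : k, algebraMap k K c ∈ O) → RelLocalUniformization k K O) ↔
      ∀ (k K : Type) [Field k] [CharP k p] [Field K] [Algebra k K],
        (⊤ : IntermediateField k K).FG → ∀ O : ValuationSubring K,
          Nonempty O.valuation.RankOne → (∀ c : k, algebraMap k K c ∈ O) →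
            IsResiduallyAlgebraic k O → RelMuPTorsorCoreStepsAt p k O := by
  constructor
  · intro h k K _ _ _ _ _ O _ hk _
    refine relCoreStepsAt_of_relLocalUniformization O hk fun K' => h k K' _ fun c => ?_
    rw [ValuationSubring.mem_comap, ← IsScalarTower.algebraMap_apply]
    exact hk c
  · intro h k K _ _ _ _ O _
    exact relLocalUniformization_of_rankOne_residuallyAlgebraic_relCoreSteps hT₁ hCP
      (fun k K _ _ _ _ hfg O hr hk hra => h k K hfg O hr hk hra) k K O

/-- **Local uniformization in characteristic `p` from the core steps at rank-one, residually
algebraic valuation rings.**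
[cite: NovacoskiSpivakovsky2014, Thm. 1.1; Temkin2013, Section 4.1; CossartPiltant2019, Thm. 1.1; Cutkosky2022, Thm. 1.3] -/
theorem localUniformizationInChar_of_rankOne_residuallyAlgebraic_relCoreSteps [Fact p.Prime]
    (hT₁ : Temkin2013HeightLeOne.{0}) (hCP : CossartPiltant2019LU3.{0})
    (H : ∀ (k K : Type) [Field k] [CharP k p] [Field K] [Algebra k K],
      (⊤ : IntermediateField k K).FG → ∀ O : ValuationSubring K,
        Nonempty O.valuation.RankOne → (∀ c : k, algebraMap k K c ∈ O) →
          IsResiduallyAlgebraic k O → RelMuPTorsorCoreStepsAt p k O) :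
    LocalUniformizationInChar.{0} p := fun k K _ _ _ _ hfg O hk =>
  isLocallyUniformizable_of_relLocalUniformization hfg O hk
    (relLocalUniformization_of_rankOne_residuallyAlgebraic_relCoreSteps hT₁ hCP H k K O)

end Global

end Literature.AlgebraicGeometry.Resolution

end
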